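import Literature.Probability.LatticeModels.FKIsingBarToRectangle
import Literature.Probability.LatticeModels.FKIsingBarHarmonicBound
import Literature.Probability.LatticeModels.RandomClusterIsoInvariance
import Literature.Probability.LatticeModels.FKIsingRSWSecondMoment
import HarnessLib

/-!
# The first-moment input of the RSW proof: `φ⁰_{4n × n}(x ↔ u) ≥ c/n` (DCHN Proposition 13)

Topic `Literature/Probability/LatticeModels`. Duminil-Copin–Hongler–Nolin's Proposition 13
(arXiv:0912.4253 §4): in the rectangle `[0, 4n] × [0, n]` with free boundary conditions, a site
`x` of the left side and a site `u` of the right side, both in the middle halves, are joined by an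
open path with probability at least `c/n`. This is exactly the hypothesis `h13` of
`fkIsing_rsw_of_connection_bounds` (`FKIsingRSWSecondMoment.lean`). PROVED here
(`fkIsing_connection_lower_bound`, 0 new facts) by assembling: the harmonic-measure bound in the
bar domain (`bar_openJoined_sq_ge`, `FKIsingBarHarmonicBound.lean`), the comparison with the
free rectangle (`fkDobrushin_openJoined_le_sum_free`, `FKIsingBarToRectangle.lean`),
finite-energy moves of the endpoints along staircase walks (`exists_walk_rect`,
`rect_reachable_move_end`), and the transposition symmetry of `ℤ²`
(`fkIsingFiniteMeasure_real_openCrossing_image_free`); small `n < 40` by finite energy along a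
staircase path.

* `rect_tall_connection_bound`: the bound in the tall rectangle `[0, n] × [0, 4n]`, `n ≥ 40`,
  with the explicit constant `p'^4 √κ/(32(n+1))`, `p' = p_c/(p_c + 2(1-p_c))`,
  `κ = 3 e^{-4π}(1-τ)/(4-τ)`.
* **`fkIsing_connection_lower_bound`**: `∃ c > 0, ∀ n ≥ 1, … c/n ≤ φ⁰(x ↔ u)`.

## References

* H. Duminil-Copin, C. Hongler, P. Nolin, *Connection probabilities and RSW-type bounds for the
  two-dimensional FK Ising model*, Comm. Pure Appl. Math. 64 (2011), §4, Proposition 13 — bib key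
  `DuminilCopinHonglerNolin2011`.
* H. Duminil-Copin, S. Smirnov, *Conformal invariance of lattice models*, Clay Math. Proc. 15
  (2012), §7.2 (proof of Thm. 3.16, Step 1) — bib key `DuminilCopinSmirnov2012Clay`.
-/

noncomputable section

namespace Literature.Probability.LatticeModels

open MeasureTheory Finset SimpleGraph
open Literature.Probability.Percolation

namespace LatticeDobrushin

/-! ### Staircase walks in a lattice rectangle -/

section Walks

variable {a b : ℕ}

/-- The nearest-neighbour graph of the lattice rectangle `[0, a] × [0, b]` (the graph of
`fkIsingFiniteMeasure (rectangle a b)`). [folklore] -/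
abbrev rectGraph (a b : ℕ) : SimpleGraph (RectV a b) :=
  (zdGraph 2).induce ((Percolation.rectangle a b : Finset (Site 2)) : Set (Site 2))

/-- Adjacency in the rectangle graph is lattice adjacency. [folklore] -/
theorem rectGraph_adj_iff {v w : RectV a b} : (rectGraph a b).Adj v w ↔ (zdGraph 2).Adj v.1 w.1 := by
  simp [SimpleGraph.comap_adj]

/-- A horizontal walk to the right: from `v` to the site `d` steps to its right on the same row. [folklore] -/
theorem exists_walk_right (d : ℕ) : ∀ (v w : RectV a b), v.1 1 = w.1 1 → w.1 0 = v.1 0 + d →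
    ∃ p : (rectGraph a b).Walk v w, p.length = d := by
  induction d with
  | zero =>
    intro v w h1 h0
    have : v = w := by
      apply Subtype.ext; funext i; fin_cases i
      · simp at h0 ⊢; omega
      · exact h1
    subst this
    exact ⟨SimpleGraph.Walk.nil, rfl⟩
  | succ d ih =>
    intro v w h1 h0
    have hv := Percolation.mem_rectangle_iff.1 (Finset.mem_coe.1 v.2)
    have hw := Percolation.mem_rectangle_iff.1 (Finset.mem_coe.1 w.2)
    set v' : RectV a b := ⟨v.1 + Pi.single 0 1, Finset.mem_coe.2 (Percolation.mem_rectangle_iff.2 (by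
      simp only [Pi.add_apply, Pi.single_apply]; simp; push_cast at h0; omega))⟩ with hv'
    have hadj : (rectGraph a b).Adj v v' := by
      rw [rectGraph_adj_iff, zdGraph_adj_iff]; exact ⟨0, Or.inl rfl⟩
    obtain ⟨p, hp⟩ := ih v' w (by simp [hv', h1]) (by simp [hv']; push_cast at h0; omega)
    exact ⟨SimpleGraph.Walk.cons hadj p, by rw [SimpleGraph.Walk.length_cons, hp]⟩

/-- A vertical walk upwards. [folklore] -/
theorem exists_walk_up (d : ℕ) : ∀ (v w : RectV a b), v.1 0 = w.1 0 → w.1 1 = v.1 1 + d →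
    ∃ p : (rectGraph a b).Walk v w, p.length = d := by
  induction d with
  | zero =>
    intro v w h0 h1
    have : v = w := by
      apply Subtype.ext; funext i; fin_cases i
      · exact h0
      · simp at h1 ⊢; omega
    subst this
    exact ⟨SimpleGraph.Walk.nil, rfl⟩
  | succ d ih =>
    intro v w h0 h1
    have hv := Percolation.mem_rectangle_iff.1 (Finset.mem_coe.1 v.2)
    have hw := Percolation.mem_rectangle_iff.1 (Finset.mem_coe.1 w.2)
    set v' : RectV a b := ⟨v.1 + Pi.single 1 1, Finset.mem_coe.2 (Percolation.mem_rectangle_iff.2 (by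
      simp only [Pi.add_apply, Pi.single_apply]; simp; push_cast at h1; omega))⟩ with hv'
    have hadj : (rectGraph a b).Adj v v' := by
      rw [rectGraph_adj_iff, zdGraph_adj_iff]; exact ⟨1, Or.inl rfl⟩
    obtain ⟨p, hp⟩ := ih v' w (by simp [hv', h0]) (by simp [hv']; push_cast at h1; omega)
    exact ⟨SimpleGraph.Walk.cons hadj p, by rw [SimpleGraph.Walk.length_cons, hp]⟩

/-- A horizontal walk between two sites of the same row, of length the distance. [folklore] -/
theorem exists_walk_row (v w : RectV a b) (h1 : v.1 1 = w.1 1) :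
    ∃ p : (rectGraph a b).Walk v w, p.length = (w.1 0 - v.1 0).natAbs := by
  rcases le_total (v.1 0) (w.1 0) with h | h
  · obtain ⟨p, hp⟩ := exists_walk_right (w.1 0 - v.1 0).natAbs v w h1 (by omega)
    exact ⟨p, hp⟩
  · obtain ⟨p, hp⟩ := exists_walk_right (w.1 0 - v.1 0).natAbs w v h1.symm (by omega)
    exact ⟨p.reverse, by rw [SimpleGraph.Walk.length_reverse, hp]⟩

/-- A vertical walk between two sites of the same column, of length the distance. [folklore] -/
theorem exists_walk_col (v w : RectV a b) (h0 : v.1 0 = w.1 0) :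
    ∃ p : (rectGraph a b).Walk v w, p.length = (w.1 1 - v.1 1).natAbs := by
  rcases le_total (v.1 1) (w.1 1) with h | h
  · obtain ⟨p, hp⟩ := exists_walk_up (w.1 1 - v.1 1).natAbs v w h0 (by omega)
    exact ⟨p, hp⟩
  · obtain ⟨p, hp⟩ := exists_walk_up (w.1 1 - v.1 1).natAbs w v h0.symm (by omega)
    exact ⟨p.reverse, by rw [SimpleGraph.Walk.length_reverse, hp]⟩

/-- **A staircase walk** between any two sites of the rectangle, of length the `ℓ¹` distance. [folklore] -/
theorem exists_walk_rect (v w : RectV a b) :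
    ∃ p : (rectGraph a b).Walk v w, p.length = (w.1 0 - v.1 0).natAbs + (w.1 1 - v.1 1).natAbs := by
  have hv := Percolation.mem_rectangle_iff.1 (Finset.mem_coe.1 v.2)
  have hw := Percolation.mem_rectangle_iff.1 (Finset.mem_coe.1 w.2)
  set m : RectV a b := ⟨![w.1 0, v.1 1], Finset.mem_coe.2 (Percolation.mem_rectangle_iff.2 (by simp; omega))⟩ with hm
  obtain ⟨p₁, hp₁⟩ := exists_walk_row v m (by simp [hm])
  obtain ⟨p₂, hp₂⟩ := exists_walk_col m w (by simp [hm])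
  refine ⟨p₁.append p₂, ?_⟩
  rw [SimpleGraph.Walk.length_append, hp₁, hp₂]
  simp [hm]

end Walks

/-! ### The tall rectangle: `φ⁰(x ↔ u) ≥ κ'/(n+1)` for `x` on the bottom and `u` on the top -/

/-- The finite-energy ratio `p' = p_c/(p_c + 2(1 - p_c))` of the critical FK-Ising model. [folklore] -/
def fkIsingEdgeRatio : ℝ := criticalFKIsingParam / (criticalFKIsingParam + 2 * (1 - criticalFKIsingParam))

/-- `p' > 0`. [folklore] -/
theorem fkIsingEdgeRatio_pos : 0 < fkIsingEdgeRatio := by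
  unfold fkIsingEdgeRatio
  have h := criticalFKIsingParam_mem_Icc
  have h0 : 0 < criticalFKIsingParam := by
    unfold criticalFKIsingParam; positivity
  apply div_pos h0
  nlinarith [h.2]

/-- `p' ≤ 1`. [folklore] -/
theorem fkIsingEdgeRatio_le_one : fkIsingEdgeRatio ≤ 1 := by
  unfold fkIsingEdgeRatio
  have h := criticalFKIsingParam_mem_Icc
  have h0 : 0 < criticalFKIsingParam := by
    unfold criticalFKIsingParam; positivity
  rw [div_le_one (by nlinarith [h.2])]
  nlinarith [h.2]

/-- The constant of the harmonic-measure bound: `κ = 3 e^{-4π} (1-τ)/(4-τ)`, `τ = (√2-1)²`. [folklore] -/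
def barKappa : ℝ := 3 * Real.exp (-(4 * Real.pi)) * ((1 - (Real.sqrt 2 - 1) ^ 2) / (4 - (Real.sqrt 2 - 1) ^ 2))

/-- `κ > 0` (`τ = (√2-1)² < 1`). [folklore] -/
theorem barKappa_pos : 0 < barKappa := by
  unfold barKappa
  have h1 : Real.sqrt 2 < 2 := by
    rw [show (2 : ℝ) = Real.sqrt 4 by rw [show (4 : ℝ) = 2 ^ 2 by norm_num, Real.sqrt_sq (by norm_num)]]
    exact Real.sqrt_lt_sqrt (by norm_num) (by norm_num)
  have h2 : 1 < Real.sqrt 2 := by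
    rw [show (1 : ℝ) = Real.sqrt 1 by simp]
    exact Real.sqrt_lt_sqrt (by norm_num) (by norm_num)
  have hτ : (Real.sqrt 2 - 1) ^ 2 < 1 := by nlinarith
  have hτ0 : 0 ≤ (Real.sqrt 2 - 1) ^ 2 := sq_nonneg _
  apply mul_pos (by positivity)
  exact div_pos (by linarith) (by linarith)

open scoped Classical in
/-- Symmetry of the connection event. [folklore] -/
theorem setOf_reachable_comm {V : Type*} (x y : V) :
    {θ : Percolation.BondConfig V | (fromEdgeSet θ).Reachable x y} = {θ | (fromEdgeSet θ).Reachable y x} := by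
  ext θ; exact ⟨fun h => h.symm, fun h => h.symm⟩

open scoped Classical in
/-- **Moving an endpoint of a connection along a short lattice path**: in the rectangle,
`p'^ℓ φ⁰(x ↔ y) ≤ φ⁰(x ↔ z)` whenever `y, z` are at `ℓ¹`-distance `≤ ℓ`. [cite: Grimmett2006, Thm. (3.8) and Thm. (3.1)(a)] -/
theorem rect_reachable_move_end {a b : ℕ} (x y z : RectV a b) (ℓ : ℕ)
    (hℓ : (z.1 0 - y.1 0).natAbs + (z.1 1 - y.1 1).natAbs ≤ ℓ) :
    fkIsingEdgeRatio ^ ℓ * (fkIsingFiniteMeasure (Percolation.rectangle a b) ∅).real {θ | (fromEdgeSet θ).Reachable x y} ≤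
      (fkIsingFiniteMeasure (Percolation.rectangle a b) ∅).real {θ | (fromEdgeSet θ).Reachable x z} := by
  obtain ⟨w, hw⟩ := exists_walk_rect y z
  have h := rcMeasure_real_reachable_ge_of_walk (rectGraph a b) criticalFKIsingParam_mem_Icc (by norm_num : (1 : ℝ) ≤ 2) ∅ x w
  change fkIsingEdgeRatio ^ w.length * (fkIsingFiniteMeasure (Percolation.rectangle a b) ∅).real _ ≤
    (fkIsingFiniteMeasure (Percolation.rectangle a b) ∅).real _ at h
  refine le_trans ?_ h
  apply mul_le_mul_of_nonneg_right _ measureReal_nonneg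
  rw [hw]
  exact pow_le_pow_of_le_one fkIsingEdgeRatio_pos.le fkIsingEdgeRatio_le_one hℓ

set_option maxHeartbeats 400000 in
open scoped Classical in
/-- **The first-moment bound in the tall rectangle** (DCHN Proposition 13, in the geometry
`[0, n] × [0, 4n]`, `x` on the bottom side and `u` on the top side, both in the middle half):
`φ⁰(x ↔ u) ≥ p'^4 √κ /(32 (n+1))` for `n ≥ 40`. Chain: the bar-domain bound
`P(x* ↔ bar)² ≥ κ/(n+1)²` (`bar_openJoined_sq_ge`, for a window `[c, c+3] ∋ u₀` and a column
`x* ∈ {x₀ - 1, x₀}` in the admissible ranges), the comparison with the free rectangle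
(`fkDobrushin_openJoined_le_sum_free`), and finite-energy moves of the endpoints (`≤ 3` steps at
the top, `≤ 1` at the bottom). [cite: DuminilCopinHonglerNolin2011, §4, Proposition 13] -/
theorem rect_tall_connection_bound {n : ℕ} (hn : 40 ≤ n) (x u : RectV n (4 * n))
    (hx1 : x.1 1 = 0) (hu1 : u.1 1 = ((4 * n : ℕ) : ℤ)) (hx0 : (n : ℤ) ≤ 4 * x.1 0) (hx0' : 4 * x.1 0 ≤ 3 * n)
    (hu0 : (n : ℤ) ≤ 4 * u.1 0) (hu0' : 4 * u.1 0 ≤ 3 * n) :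
    fkIsingEdgeRatio ^ 4 * Real.sqrt barKappa / (32 * ((n : ℝ) + 1)) ≤
      (fkIsingFiniteMeasure (Percolation.rectangle n (4 * n)) ∅).real {θ | (fromEdgeSet θ).Reachable x u} := by
  have hxm := Percolation.mem_rectangle_iff.1 (Finset.mem_coe.1 x.2)
  have hum := Percolation.mem_rectangle_iff.1 (Finset.mem_coe.1 u.2)
  -- the window
  set c : ℤ := max (u.1 0 - 3) ((n / 4 : ℕ) : ℤ) with hcdef
  have hn4 : 4 * ((n / 4 : ℕ) : ℤ) ≤ n ∧ (n : ℤ) < 4 * ((n / 4 : ℕ) : ℤ) + 4 := by omega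
  have hc : 0 ≤ c := by omega
  have hcW : c + 3 ≤ n := by omega
  have hcu : c ≤ u.1 0 ∧ u.1 0 ≤ c + 3 := by omega
  have hnr : (40 : ℝ) ≤ n := by exact_mod_cast hn
  have hcl : ((n : ℝ) + 1) / 4 ≤ (c : ℝ) + 1 := by
    have : (n : ℤ) + 1 ≤ 4 * (c + 1) := by omega
    have : ((n : ℝ) + 1) ≤ 4 * ((c : ℝ) + 1) := by exact_mod_cast this
    linarith
  have hcu' : (c : ℝ) + 3 ≤ 3 * ((n : ℝ) + 1) / 4 := by
    have : 4 * (c + 3) ≤ 3 * ((n : ℤ) + 1) := by omega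
    have : 4 * ((c : ℝ) + 3) ≤ 3 * ((n : ℝ) + 1) := by exact_mod_cast this
    linarith
  -- the adjusted bottom column
  set x₁ : ℤ := min (x.1 0) (((3 * n - 1) / 4 : ℕ) : ℤ) with hx₁def
  have hq : 4 * (((3 * n - 1) / 4 : ℕ) : ℤ) ≤ 3 * n - 1 ∧ 3 * (n : ℤ) - 1 < 4 * (((3 * n - 1) / 4 : ℕ) : ℤ) + 4 := by omega
  have hx₁0 : 0 ≤ x₁ ∧ x₁ ≤ n := by omega
  have hx₁x : x₁ ≤ x.1 0 ∧ x.1 0 ≤ x₁ + 1 := by omega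
  have hx₁l : ((n : ℝ) + 1) / 4 ≤ (x₁ : ℝ) + 1 := by
    have : (n : ℤ) + 1 ≤ 4 * (x₁ + 1) := by omega
    have : ((n : ℝ) + 1) ≤ 4 * ((x₁ : ℝ) + 1) := by exact_mod_cast this
    linarith
  have hx₁u : (x₁ : ℝ) + 1 ≤ 3 * ((n : ℝ) + 1) / 4 := by
    have : 4 * (x₁ + 1) ≤ 3 * ((n : ℤ) + 1) := by omega
    have : 4 * ((x₁ : ℝ) + 1) ≤ 3 * ((n : ℝ) + 1) := by exact_mod_cast this
    linarith
  set xs : RectV n (4 * n) := ⟨![x₁, 0], Finset.mem_coe.2 (Percolation.mem_rectangle_iff.2 (by simp; omega))⟩ with hxs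
  -- the four top sites
  set uj : Fin 4 → RectV n (4 * n) := fun j => ⟨![c + j, ((4 * n : ℕ) : ℤ)],
    Finset.mem_coe.2 (Percolation.mem_rectangle_iff.2 (by
      have : (j : ℤ) ≤ 3 := by have := j.isLt; omega
      simp; omega))⟩ with huj
  have huj' : ∀ j, rectEmb n (4 * n) c (uj j) = topSite n (4 * n) c hc hcW j := fun j => Subtype.ext rfl
  -- (1) the bar-domain bound and (2) the comparison with the free rectangle
  have hN : 7 * (n + 1) ≤ 2 * (4 * n + 1) := by omega
  have hN' : 4 * n + 1 ≤ 4 * (n + 1) := by omega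
  have hxmem : (![x₁, 0] : Site 2) ∈ meshDomain (barD n (4 * n) c).Ω (barD n (4 * n) c).δ := (rectEmb n (4 * n) c xs).2
  have hsq := bar_openJoined_sq_ge (W := n) (N := 4 * n) (c := c) hc hcW hn hN hN' hcl hcu' hx₁l hx₁u hxmem
  rw [show (3 : ℝ) * Real.exp (-(4 * Real.pi)) * ((1 - (Real.sqrt 2 - 1) ^ 2) / (4 - (Real.sqrt 2 - 1) ^ 2)) = barKappa from rfl] at hsq
  have hle := fkDobrushin_openJoined_le_sum_free (N := 4 * n) hc hcW xs uj huj'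
  have hxe : rectEmb n (4 * n) c xs = ⟨![x₁, 0], hxmem⟩ := Subtype.ext rfl
  rw [hxe] at hle
  set P := (fkDobrushinMeasure (barD n (4 * n) c)).real
    {ω | (barD n (4 * n) c).OpenJoinedToArcA ⟨![x₁, 0], hxmem⟩ ω} with hP
  have hP0 : 0 ≤ P := measureReal_nonneg
  have hPge : Real.sqrt barKappa / ((n : ℝ) + 1) ≤ P := by
    have h1 : Real.sqrt (barKappa / ((n : ℝ) + 1) ^ 2) ≤ Real.sqrt (P ^ 2) := Real.sqrt_le_sqrt hsq
    rwa [Real.sqrt_sq hP0, Real.sqrt_div' _ (sq_nonneg _), Real.sqrt_sq (by positivity)] at h1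
  -- (3) moving the endpoints
  set φ := fkIsingFiniteMeasure (Percolation.rectangle n (4 * n)) ∅ with hφ
  have hmove_top : ∀ j : Fin 4, fkIsingEdgeRatio ^ 3 * φ.real {θ | (fromEdgeSet θ).Reachable xs (uj j)} ≤
      φ.real {θ | (fromEdgeSet θ).Reachable xs u} := by
    intro j
    refine rect_reachable_move_end xs (uj j) u 3 ?_
    have : (j : ℤ) ≤ 3 := by have := j.isLt; omega
    simp only [huj]
    simp [hu1]
    omega
  have hmove_bot : fkIsingEdgeRatio ^ 1 * φ.real {θ | (fromEdgeSet θ).Reachable xs u} ≤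
      φ.real {θ | (fromEdgeSet θ).Reachable x u} := by
    rw [setOf_reachable_comm xs u, setOf_reachable_comm x u]
    refine rect_reachable_move_end u xs x 1 ?_
    simp only [hxs]
    simp [hx1]
    omega
  -- assemble
  have hr0 : 0 ≤ fkIsingEdgeRatio := fkIsingEdgeRatio_pos.le
  have hsum : fkIsingEdgeRatio ^ 3 * ∑ j : Fin 4, φ.real {θ | (fromEdgeSet θ).Reachable xs (uj j)} ≤
      4 * φ.real {θ | (fromEdgeSet θ).Reachable xs u} := by
    rw [Finset.mul_sum]
    calc ∑ j : Fin 4, fkIsingEdgeRatio ^ 3 * φ.real {θ | (fromEdgeSet θ).Reachable xs (uj j)}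
        ≤ ∑ _j : Fin 4, φ.real {θ | (fromEdgeSet θ).Reachable xs u} := Finset.sum_le_sum fun j _ => hmove_top j
      _ = 4 * φ.real {θ | (fromEdgeSet θ).Reachable xs u} := by simp
  rw [pow_one] at hmove_bot
  have hL : (0 : ℝ) < (n : ℝ) + 1 := by positivity
  have h4 : 0 ≤ fkIsingEdgeRatio ^ 4 := pow_nonneg hr0 4
  calc fkIsingEdgeRatio ^ 4 * Real.sqrt barKappa / (32 * ((n : ℝ) + 1))
      = fkIsingEdgeRatio ^ 4 * (Real.sqrt barKappa / ((n : ℝ) + 1)) / 32 := by field_simp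
    _ ≤ fkIsingEdgeRatio ^ 4 * P / 32 :=
        div_le_div_of_nonneg_right (mul_le_mul_of_nonneg_left hPge h4) (by norm_num)
    _ ≤ fkIsingEdgeRatio ^ 4 * (8 * ∑ j : Fin 4, φ.real {θ | (fromEdgeSet θ).Reachable xs (uj j)}) / 32 :=
        div_le_div_of_nonneg_right (mul_le_mul_of_nonneg_left hle h4) (by norm_num)
    _ = fkIsingEdgeRatio * (fkIsingEdgeRatio ^ 3 * ∑ j : Fin 4, φ.real {θ | (fromEdgeSet θ).Reachable xs (uj j)}) / 4 := by ring
    _ ≤ fkIsingEdgeRatio * (4 * φ.real {θ | (fromEdgeSet θ).Reachable xs u}) / 4 :=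
        div_le_div_of_nonneg_right (mul_le_mul_of_nonneg_left hsum hr0) (by norm_num)
    _ = fkIsingEdgeRatio * φ.real {θ | (fromEdgeSet θ).Reachable xs u} := by ring
    _ ≤ φ.real {θ | (fromEdgeSet θ).Reachable x u} := hmove_bot

/-! ### Transposition to the wide rectangle and the first-moment bound `h13` -/

/-- The transposition maps `rectangle n (4n)` onto `rectangle (4n) n`. [folklore] -/
theorem mem_rectangle_transpose_iff (n : ℕ) (y : Site 2) :
    y ∈ Percolation.rectangle (4 * n) n ↔ transposeIso.symm y ∈ Percolation.rectangle n (4 * n) := by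
  rw [transposeIso_symm_apply, transposeIso_apply, Percolation.mem_rectangle_iff, Percolation.mem_rectangle_iff]
  simp only [Matrix.cons_val_zero, Matrix.cons_val_one]
  push_cast
  tauto

open scoped Classical in
/-- A singleton open crossing is a point-to-point open connection. [folklore] -/
theorem openCrossing_singleton {V : Type*} (S : Set V) (x y : V) :
    openCrossing S {x} {y} = openConnIn S x y := by
  ext ω; simp [openCrossing]

set_option maxHeartbeats 400000 in
open scoped Classical in
/-- **DCHN Proposition 13 / the first-moment input `h13` of the RSW proof.** There is `c > 0`
such that for every `n ≥ 1` and all sites `x` on the left side and `u` on the right side of the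
rectangle `[0, 4n] × [0, n]`, both in the middle halves of their sides,
`φ⁰_{p_sd, 2, R}(x ↔ u) ≥ c/n`. For `n ≥ 40` this is `rect_tall_connection_bound` transported by
the transposition of `ℤ²` (`fkIsingFiniteMeasure_real_openCrossing_image_free`); for `n < 40` the
finite-energy bound along a staircase path. [cite: DuminilCopinHonglerNolin2011, §4, Proposition 13] -/
theorem fkIsing_connection_lower_bound :
    ∃ c : ℝ, 0 < c ∧ ∀ n : ℕ, 1 ≤ n →
      ∀ x u : ↥((Percolation.rectangle (4 * n) n : Finset (Site 2)) : Set (Site 2)),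
        x.1 0 = 0 → u.1 0 = ((4 * n : ℕ) : ℤ) → (n : ℤ) ≤ 4 * x.1 1 → 4 * x.1 1 ≤ 3 * n →
        (n : ℤ) ≤ 4 * u.1 1 → 4 * u.1 1 ≤ 3 * n →
        c / n ≤ (fkIsingFiniteMeasure (Percolation.rectangle (4 * n) n) ∅).real (openConnIn Set.univ x u) := by
  set C₁ : ℝ := fkIsingEdgeRatio ^ 200 with hC₁
  set C₂ : ℝ := fkIsingEdgeRatio ^ 4 * Real.sqrt barKappa / 64 with hC₂
  have hr0 := fkIsingEdgeRatio_pos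
  have hr1 := fkIsingEdgeRatio_le_one
  have hC₁0 : 0 < C₁ := pow_pos hr0 _
  have hC₂0 : 0 < C₂ := by
    rw [hC₂]; exact div_pos (mul_pos (pow_pos hr0 _) (Real.sqrt_pos.2 barKappa_pos)) (by norm_num)
  refine ⟨min C₁ C₂, lt_min hC₁0 hC₂0, fun n hn x u hx hu hx1 hx1' hu1 hu1' => ?_⟩
  have hnr : (1 : ℝ) ≤ n := by exact_mod_cast hn
  -- the event as a reachability event
  have hevent : (openConnIn Set.univ x u : Set (Percolation.BondConfig _)) = {θ | (fromEdgeSet θ).Reachable x u} := by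
    ext θ; rw [mem_openConnIn_univ_iff]; rfl
  by_cases h40 : 40 ≤ n
  · -- transport from the tall rectangle
    set g := transposeIso with hg
    have hmem := mem_rectangle_transpose_iff n
    set ψ := finsetGraphIso g hmem with hψ
    set x' := ψ.symm x with hx'
    set u' := ψ.symm u with hu'
    have hx'v : x'.1 = ![x.1 1, x.1 0] := by
      rw [hx']; change g.symm x.1 = _; rw [transposeIso_symm_apply, transposeIso_apply]
    have hu'v : u'.1 = ![u.1 1, u.1 0] := by
      rw [hu']; change g.symm u.1 = _; rw [transposeIso_symm_apply, transposeIso_apply]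
    have htall := rect_tall_connection_bound h40 x' u' (by rw [hx'v]; simp [hx]) (by rw [hu'v]; simp [hu])
      (by rw [hx'v]; simpa using hx1) (by rw [hx'v]; simpa using hx1') (by rw [hu'v]; simpa using hu1)
      (by rw [hu'v]; simpa using hu1')
    have htrans := fkIsingFiniteMeasure_real_openCrossing_image_free g hmem Set.univ {x'} {u'}
    rw [image_finsetGraphIso_univ', Set.image_singleton, Set.image_singleton,
      show ψ x' = x from ψ.apply_symm_apply x, show ψ u' = u from ψ.apply_symm_apply u,
      openCrossing_singleton, openCrossing_singleton] at htrans
    rw [htrans]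
    have hevent' : (openConnIn Set.univ x' u' : Set (Percolation.BondConfig _)) = {θ | (fromEdgeSet θ).Reachable x' u'} := by
      ext θ; rw [mem_openConnIn_univ_iff]; rfl
    rw [hevent']
    refine le_trans ?_ htall
    have hn2 : (n : ℝ) + 1 ≤ 2 * n := by linarith
    have hnum : 0 ≤ fkIsingEdgeRatio ^ 4 * Real.sqrt barKappa := mul_nonneg (pow_nonneg hr0.le 4) (Real.sqrt_nonneg _)
    calc min C₁ C₂ / n ≤ C₂ / n := div_le_div_of_nonneg_right (min_le_right _ _) (by positivity)
      _ = fkIsingEdgeRatio ^ 4 * Real.sqrt barKappa / (32 * (2 * n)) := by rw [hC₂]; field_simp; ring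
      _ ≤ fkIsingEdgeRatio ^ 4 * Real.sqrt barKappa / (32 * ((n : ℝ) + 1)) :=
          div_le_div_of_nonneg_left hnum (by positivity) (by linarith)
  · -- small `n`: a staircase path of length `≤ 5n ≤ 200`
    push Not at h40
    rw [hevent]
    obtain ⟨w, hw⟩ := exists_walk_rect x u
    have hxm := Percolation.mem_rectangle_iff.1 (Finset.mem_coe.1 x.2)
    have hum := Percolation.mem_rectangle_iff.1 (Finset.mem_coe.1 u.2)
    have hlen : w.length ≤ 200 := by
      rw [hw]; push_cast at hxm hum hu; omega
    have hpath := rcMeasure_real_reachable_ge_pow (rectGraph (4 * n) n) criticalFKIsingParam_mem_Icc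
      (by norm_num : (1 : ℝ) ≤ 2) ∅ w
    change fkIsingEdgeRatio ^ w.length ≤ (fkIsingFiniteMeasure (Percolation.rectangle (4 * n) n) ∅).real _ at hpath
    refine le_trans ?_ hpath
    calc min C₁ C₂ / n ≤ C₁ / n := div_le_div_of_nonneg_right (min_le_left _ _) (by positivity)
      _ ≤ C₁ := div_le_self hC₁0.le hnr
      _ ≤ fkIsingEdgeRatio ^ w.length := pow_le_pow_of_le_one hr0.le hr1 hlen

end LatticeDobrushin

end Literature.Probability.LatticeModels
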